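import Mathlib
import HarnessLib
import Summits.HubbardSuperconductivity.HubbardSuperconductivity.Theorems.KLProgrammeKLRegimeEngineV8PairTransferRelBarF

/-!
# Route `KLProgramme` — ENGINE child gen 8 (stmt-HubbardSuperconductivity-20437 `KLRegimeEngineV17F2`): located risk #15 «(E2)-FRZ-LOG», option (β′) —
# the SUMMABILITY of the relative gain profile and the generic G-amendment `GeoConsts.addShellLog` (frozen-branch shell count + `2^{−n}` floor), WF-preserving,
# with the HOSTING inequality for the relative bar (cell gate-hubbard-kl, seat hubbard-kl-k3c1-p1 g10; plan g20 (R54i)/(R54p): (β′) ≻ (δ), decision 08-28 18:00Z)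

WHY.  The relative family (class #5 rev 3) closes with derived definitions (`klRelGain`, `transferBarRelAtW(F)`, p586507/RelBarF); the ONE place a `G` question
arises is the CONSUMER bridge `relative bar of (ψ|0) ≤ transferBarAt G …` (rev 2's consumer clause, step 3): rev 2's ph slot `G.phGain` must host
`c₀·klRelGain n ρ` (whose frozen branch carries the shell count `1 + kₙ(ρ)` — the recount (R54p): the residue pairs the soft difference line with the accumulated HARD
history in the particle–hole channel, one unit `≍ Λ_D/(v²ρ)` per hard shell below `ρ`) and the `2^{−n}` slots.  `klEngGeo8.phGain`'s frozen branch `2^52·Λₙ/ρ` does so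
only for `kₙ(ρ) ≤ 2^52/c₀` (depth `> 2^50`: physically void, formally a hole).  Option (β′) = amend the package.  This file makes (β′) ONE LINE
(`klEngGeo9 := klEngGeo8.addShellLog C`, names-only for every other row) by proving, generically in `G`:
* §1 **`sum_range_klRelGain_le`**: `Σ_{n<N} klRelGain n ρ ≤ 40/9` for every `ρ ≥ 0`, every `N` — UNIFORMLY (near part `Σ ρ/Λₙ ≤ 4/3` over `Λₙ > ρ`, frozen part
  `Σ Λₙ/ρ ≤ 4/3` over `Λₙ ≤ ρ`, and the shell-count part by exchanging the sums: each hard shell `j` below `ρ` contributes `(Λ_j/ρ)·Σ_{n≥j}4^{−(n−j)} ≤ (4/3)Λ_j/ρ`,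
  and `Σ_{Λ_j ≤ ρ} Λ_j/ρ ≤ 4/3`) — the log is summable because it multiplies a geometrically decaying profile (Lindhard is finite);
* §2 **`GeoConsts.addShellLog G C := {G with phGain := G.phGain + C·(klRelGain n (ρ ⊔ 0) + 2^{−n}), CF := G.CF + 7C}`**, field lemmas, **`addShellLog_wf`**
  (`G.WF → 0 ≤ C → (G.addShellLog C).WF`: the uniform ph-gain sum clause survives with `CF + 7C`), `phGain_le_addShellLog`, `klRelGain_le_addShellLog`,
  `addShellLog_phGain_pred_le` (`pred_le` survives);
* §3 **`transferBarRelAtWF_le_transferBarAt_addShellLog`**: for weights `0 ≤ ms, ov ≤ c` and constants `r·c ≤ r′`, `r·c ≤ r′·C`: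
  `transferBarRelAtWF G P r β U n ms ov ≤ transferBarAt (G.addShellLog C) P r′ β U n` at every label — the bridge hypothesis of `pairTransferPinnedAt_of_rel` /
  `PairTransferRelFamily.pinnedFamily` DISCHARGED for the amended package (with `c = 15367` for admissible pairs, `klSoftMass_sub_le_of_isSoftSymbol`, p586307).
Real arithmetic only; no package of record is touched here (the one-line `klEngGeo9` and its row re-keys are the pen's (β′) decision); nothing about the model is asserted.  0 kit.
-/

noncomputable section

namespace Summit.HubbardSuperconductivity.HubbardSuperconductivity.Theorems.KLRegimeSplit

set_option linter.dupNamespace false -- summit = problem name (single-conjunct summit), D-0017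

open Real Finset Literature.MathematicalPhysics.QuantumLattice Literature.Probability.LatticeModels
open Summit.HubbardSuperconductivity.HubbardSuperconductivity.Theorems.KLProgrammeLegKernels
open Summit.HubbardSuperconductivity.HubbardSuperconductivity.Theorems.DispersionFlow

/-! ## §1 Uniform summability of the relative gain profile -/

section Summability

/-- The geometric tail: `Σ_{i ∈ s} (1/4)^i ≤ 4/3` for every finite set of exponents. -/
theorem klsl_sum_quarter_pow_le (s : Finset ℕ) : ∑ i ∈ s, ((1 : ℝ) / 4) ^ i ≤ 4 / 3 := by
  have hq0 : (0 : ℝ) ≤ 1 / 4 := by norm_num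
  have hq1 : (1 : ℝ) / 4 < 1 := by norm_num
  have hsum : Summable fun i : ℕ => ((1 : ℝ) / 4) ^ i := summable_geometric_of_lt_one hq0 hq1
  calc ∑ i ∈ s, ((1 : ℝ) / 4) ^ i ≤ ∑' i : ℕ, ((1 : ℝ) / 4) ^ i := Summable.sum_le_tsum s (fun i _ => by positivity) hsum
    _ = 4 / 3 := by rw [tsum_geometric_of_lt_one hq0 hq1]; norm_num

/-- `Λ_m = (1/4)^{m−n}·Λ_n` for `n ≤ m`. -/
theorem klScale_eq_quarter_pow_mul {n m : ℕ} (hnm : n ≤ m) : klScale klE0 m = ((1 : ℝ) / 4) ^ (m - n) * klScale klE0 n := by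
  rw [klScale_eq_pow_mul_of_le hnm, one_div, inv_pow]

/-- **Frozen part**: `Σ_{j<N, Λ_j ≤ ρ} Λ_j/ρ ≤ 4/3` (`0 < ρ`) — a geometric series from the first hard shell below `ρ`. -/
theorem sum_filter_klScale_div_le (N : ℕ) {ρ : ℝ} (hρ : 0 < ρ) :
    ∑ j ∈ (range N).filter (fun j => klScale klE0 j ≤ ρ), klScale klE0 j / ρ ≤ 4 / 3 := by
  set J := (range N).filter (fun j => klScale klE0 j ≤ ρ) with hJ
  rcases J.eq_empty_or_nonempty with hE | hne
  · rw [hE, sum_empty]; norm_num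
  set j₀ := J.min' hne with hj₀
  have hj₀mem : j₀ ∈ J := min'_mem J hne
  have hj₀ρ : klScale klE0 j₀ ≤ ρ := (mem_filter.mp hj₀mem).2
  have hle : ∀ j ∈ J, klScale klE0 j / ρ ≤ ((1 : ℝ) / 4) ^ (j - j₀) := by
    intro j hj
    have hjj : j₀ ≤ j := min'_le J j hj
    rw [klScale_eq_quarter_pow_mul hjj, div_le_iff₀ hρ]
    exact mul_le_mul_of_nonneg_left hj₀ρ (by positivity)
  calc ∑ j ∈ J, klScale klE0 j / ρ ≤ ∑ j ∈ J, ((1 : ℝ) / 4) ^ (j - j₀) := sum_le_sum hle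
    _ = ∑ i ∈ J.image (fun j => j - j₀), ((1 : ℝ) / 4) ^ i := by
        rw [sum_image]
        intro a ha b hb hab
        have ha' : j₀ ≤ a := min'_le J a ha
        have hb' : j₀ ≤ b := min'_le J b hb
        simp only at hab
        omega
    _ ≤ 4 / 3 := klsl_sum_quarter_pow_le _

/-- **Near part**: `Σ_{n<N, ρ < Λₙ} ρ/Λₙ ≤ 4/3` — a geometric series down from the last shell above `ρ`. -/
theorem sum_filter_div_klScale_le (N : ℕ) (ρ : ℝ) :
    ∑ n ∈ (range N).filter (fun n => ρ < klScale klE0 n), ρ / klScale klE0 n ≤ 4 / 3 := by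
  set J := (range N).filter (fun n => ρ < klScale klE0 n) with hJ
  rcases J.eq_empty_or_nonempty with hE | hne
  · rw [hE, sum_empty]; norm_num
  set n₁ := J.max' hne with hn₁
  have hn₁mem : n₁ ∈ J := max'_mem J hne
  have hn₁ρ : ρ < klScale klE0 n₁ := (mem_filter.mp hn₁mem).2
  have hΛ₁ : 0 < klScale klE0 n₁ := klth_klScale_pos n₁
  have hle : ∀ n ∈ J, ρ / klScale klE0 n ≤ ((1 : ℝ) / 4) ^ (n₁ - n) := by
    intro n hn
    have hnn : n ≤ n₁ := le_max' J n hn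
    have hΛn : 0 < klScale klE0 n := klth_klScale_pos n
    -- `Λ_{n₁} = (1/4)^{n₁−n}·Λ_n`, so `ρ/Λ_n = (ρ/Λ_{n₁})·(1/4)^{n₁−n} ≤ (1/4)^{n₁−n}`
    have e := klScale_eq_quarter_pow_mul hnn
    have hq : 0 < ((1 : ℝ) / 4) ^ (n₁ - n) := by positivity
    have hρ1 : ρ / klScale klE0 n₁ ≤ 1 := (div_le_one hΛ₁).mpr hn₁ρ.le
    have : ρ / klScale klE0 n = (ρ / klScale klE0 n₁) * ((1 : ℝ) / 4) ^ (n₁ - n) := by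
      rw [e]; field_simp
    rw [this]
    exact mul_le_of_le_one_left hq.le hρ1
  calc ∑ n ∈ J, ρ / klScale klE0 n ≤ ∑ n ∈ J, ((1 : ℝ) / 4) ^ (n₁ - n) := sum_le_sum hle
    _ = ∑ i ∈ J.image (fun n => n₁ - n), ((1 : ℝ) / 4) ^ i := by
        rw [sum_image]
        intro a ha b hb hab
        have ha' : a ≤ n₁ := le_max' J a ha
        have hb' : b ≤ n₁ := le_max' J b hb
        simp only at hab
        omega
    _ ≤ 4 / 3 := klsl_sum_quarter_pow_le _

/-- **The symmetric factor is summable**: `Σ_{n<N} min(ρ/Λₙ, Λₙ/ρ) ≤ 8/3` (`0 ≤ ρ`). -/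
theorem sum_range_min_div_le (N : ℕ) {ρ : ℝ} (hρ : 0 ≤ ρ) :
    ∑ n ∈ range N, min (ρ / klScale klE0 n) (klScale klE0 n / ρ) ≤ 8 / 3 := by
  rcases hρ.eq_or_lt with h0 | hρ0
  · subst h0; simp only [zero_div, div_zero, min_self, sum_const_zero]; norm_num
  rw [← sum_filter_add_sum_filter_not (range N) (fun n => ρ < klScale klE0 n)]
  have h1 : ∑ n ∈ (range N).filter (fun n => ρ < klScale klE0 n), min (ρ / klScale klE0 n) (klScale klE0 n / ρ) ≤ 4 / 3 :=
    (sum_le_sum fun n _ => min_le_left _ _).trans (sum_filter_div_klScale_le N ρ)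
  have h2 : ∑ n ∈ (range N).filter (fun n => ¬ρ < klScale klE0 n), min (ρ / klScale klE0 n) (klScale klE0 n / ρ) ≤ 4 / 3 := by
    have hf : (range N).filter (fun n => ¬ρ < klScale klE0 n) = (range N).filter (fun n => klScale klE0 n ≤ ρ) :=
      filter_congr fun n _ => not_lt
    rw [hf]
    exact (sum_le_sum fun n _ => min_le_right _ _).trans (sum_filter_klScale_div_le N hρ0)
  linarith

/-- **The shell-count part, termwise**: for `0 < ρ`,
`klRelGain n ρ ≤ min(ρ/Λₙ, Λₙ/ρ) + Σ_{j ≤ n, Λ_j ≤ ρ} (Λ_j/ρ)·(1/4)^{n−j}` (each counted shell `j` has `Λₙ = (1/4)^{n−j}Λ_j`, and `min ≤ Λₙ/ρ`). -/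
theorem klRelGain_le_min_add_sum (n : ℕ) {ρ : ℝ} (hρ : 0 < ρ) :
    klRelGain n ρ ≤ min (ρ / klScale klE0 n) (klScale klE0 n / ρ) +
      ∑ j ∈ (range (n + 1)).filter (fun j => klScale klE0 j ≤ ρ), klScale klE0 j / ρ * ((1 : ℝ) / 4) ^ (n - j) := by
  unfold klRelGain klShellCount
  have hΛ : 0 < klScale klE0 n := klth_klScale_pos n
  have hm0 : 0 ≤ min (ρ / klScale klE0 n) (klScale klE0 n / ρ) := le_min (by positivity) (by positivity)
  rw [mul_add, mul_one, card_eq_sum_ones, Nat.cast_sum, mul_sum]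
  refine add_le_add le_rfl (sum_le_sum fun j hj => ?_)
  have hjn : j ≤ n := by have := (mem_filter.mp hj).1; simpa [mem_range, Nat.lt_succ_iff] using this
  rw [Nat.cast_one, mul_one]
  calc min (ρ / klScale klE0 n) (klScale klE0 n / ρ) ≤ klScale klE0 n / ρ := min_le_right _ _
    _ = klScale klE0 j / ρ * ((1 : ℝ) / 4) ^ (n - j) := by rw [klScale_eq_quarter_pow_mul hjn]; ring

/-- **UNIFORM SUMMABILITY of the relative gain**: `Σ_{n<N} klRelGain n ρ ≤ 40/9` for every `ρ ≥ 0` and every `N`. -/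
theorem sum_range_klRelGain_le (N : ℕ) {ρ : ℝ} (hρ : 0 ≤ ρ) : ∑ n ∈ range N, klRelGain n ρ ≤ 40 / 9 := by
  rcases hρ.eq_or_lt with h0 | hρ0
  · subst h0; simp only [klRelGain_zero, sum_const_zero]; norm_num
  -- termwise split
  have h1 := sum_range_min_div_le N hρ
  have h2 : ∑ n ∈ range N, ∑ j ∈ (range (n + 1)).filter (fun j => klScale klE0 j ≤ ρ), klScale klE0 j / ρ * ((1 : ℝ) / 4) ^ (n - j) ≤ 16 / 9 := by
    -- exchange the sums: every hard shell `j` below `ρ` contributes `(Λ_j/ρ)·Σ_{n ∈ [j,N)} (1/4)^{n−j} ≤ (4/3)·Λ_j/ρ`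
    have hcomm := Finset.sum_comm' (s := range N) (t := fun n => (range (n + 1)).filter (fun j => klScale klE0 j ≤ ρ))
      (t' := (range N).filter (fun j => klScale klE0 j ≤ ρ)) (s' := fun j => Ico j N)
      (f := fun n j => klScale klE0 j / ρ * ((1 : ℝ) / 4) ^ (n - j)) ?_
    · rw [hcomm]
      calc ∑ j ∈ (range N).filter (fun j => klScale klE0 j ≤ ρ), ∑ n ∈ Ico j N, klScale klE0 j / ρ * ((1 : ℝ) / 4) ^ (n - j)
            ≤ ∑ j ∈ (range N).filter (fun j => klScale klE0 j ≤ ρ), klScale klE0 j / ρ * (4 / 3) := by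
              refine sum_le_sum fun j _ => ?_
              rw [← mul_sum]
              refine mul_le_mul_of_nonneg_left ?_ (by have := klth_klScale_pos j; positivity)
              rw [sum_Ico_eq_sum_range]
              calc ∑ k ∈ range (N - j), ((1 : ℝ) / 4) ^ (j + k - j) = ∑ k ∈ range (N - j), ((1 : ℝ) / 4) ^ k :=
                    sum_congr rfl fun k _ => by rw [Nat.add_sub_cancel_left]
                _ ≤ 4 / 3 := klsl_sum_quarter_pow_le _
        _ = (∑ j ∈ (range N).filter (fun j => klScale klE0 j ≤ ρ), klScale klE0 j / ρ) * (4 / 3) := by rw [sum_mul]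
        _ ≤ 4 / 3 * (4 / 3) := by
              have := sum_filter_klScale_div_le N hρ0
              nlinarith
        _ = 16 / 9 := by norm_num
    · intro n j
      simp only [mem_Ico, mem_filter, mem_range, Nat.lt_succ_iff]
      constructor
      · rintro ⟨hnN, hjn, hj⟩; exact ⟨⟨hjn, hnN⟩, by omega, hj⟩
      · rintro ⟨⟨hjn, hnN⟩, -, hj⟩; exact ⟨hnN, hjn, hj⟩
  calc ∑ n ∈ range N, klRelGain n ρ
      ≤ ∑ n ∈ range N, (min (ρ / klScale klE0 n) (klScale klE0 n / ρ) +
          ∑ j ∈ (range (n + 1)).filter (fun j => klScale klE0 j ≤ ρ), klScale klE0 j / ρ * ((1 : ℝ) / 4) ^ (n - j)) :=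
        sum_le_sum fun n _ => klRelGain_le_min_add_sum n hρ0
    _ ≤ 8 / 3 + 16 / 9 := by rw [sum_add_distrib]; exact add_le_add h1 h2
    _ = 40 / 9 := by norm_num

/-- `pred_le` for the relative gain: `klRelGain (n−1) ρ ≤ 4·klRelGain n ρ` (`0 ≤ ρ`). -/
theorem klRelGain_pred_le (n : ℕ) {ρ : ℝ} (hρ : 0 ≤ ρ) : klRelGain (n - 1) ρ ≤ 4 * klRelGain n ρ := by
  rcases Nat.eq_zero_or_pos n with h0 | hn
  · subst h0
    have := klRelGain_nonneg 0 hρ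
    simp only [Nat.zero_sub]; linarith
  · obtain ⟨k, rfl⟩ : ∃ k, n = k + 1 := ⟨n - 1, by omega⟩
    rw [Nat.add_sub_cancel]
    have h := klRelGain_succ_room k hρ
    have hu : 0 ≤ min (ρ / klScale klE0 (k + 1)) (klScale klE0 (k + 1) / ρ) :=
      le_min (div_nonneg hρ (klth_klScale_pos _).le) (div_nonneg (klth_klScale_pos _).le hρ)
    linarith

end Summability

/-! ## §2 The amendment `GeoConsts.addShellLog` -/

/-- **`G.addShellLog C`** — the geometric package `G` with the particle–hole gain amended by the relative gain profile and a `2^{−n}` floor: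
`phGain n ρ := G.phGain n ρ + C·(klRelGain n (ρ ⊔ 0) + 2^{−n})`, `CF := G.CF + 7C`; every other field untouched. -/
def GeoConsts.addShellLog (G : GeoConsts) (C : ℝ) : GeoConsts :=
  { G with phGain := fun n ρ => G.phGain n ρ + C * (klRelGain n (max ρ 0) + ((2 : ℝ) ^ n)⁻¹), CF := G.CF + 7 * C }

namespace GeoConsts

variable (G : GeoConsts) (C : ℝ)

/-- the amended ph gain -/
theorem addShellLog_phGain (n : ℕ) (ρ : ℝ) : (G.addShellLog C).phGain n ρ = G.phGain n ρ + C * (klRelGain n (max ρ 0) + ((2 : ℝ) ^ n)⁻¹) := rfl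
/-- the amended freezing constant -/
theorem addShellLog_CF : (G.addShellLog C).CF = G.CF + 7 * C := rfl
/-- untouched field `ppGain` -/
theorem addShellLog_ppGain : (G.addShellLog C).ppGain = G.ppGain := rfl
/-- untouched field `cE4` -/
theorem addShellLog_cE4 : (G.addShellLog C).cE4 = G.cE4 := rfl
/-- untouched field `atop` -/
theorem addShellLog_atop : (G.addShellLog C).atop = G.atop := rfl
/-- untouched field `abot` -/
theorem addShellLog_abot : (G.addShellLog C).abot = G.abot := rfl
/-- untouched field `blo` -/
theorem addShellLog_blo : (G.addShellLog C).blo = G.blo := rfl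
/-- untouched field `bhi` -/
theorem addShellLog_bhi : (G.addShellLog C).bhi = G.bhi := rfl
/-- untouched field `cloc` -/
theorem addShellLog_cloc : (G.addShellLog C).cloc = G.cloc := rfl
/-- untouched field `θ` -/
theorem addShellLog_θ : (G.addShellLog C).θ = G.θ := rfl
/-- untouched field `a` -/
theorem addShellLog_a : (G.addShellLog C).a = G.a := rfl
/-- untouched field `ζ` -/
theorem addShellLog_ζ : (G.addShellLog C).ζ = G.ζ := rfl
/-- untouched field `Z` -/
theorem addShellLog_Z : (G.addShellLog C).Z = G.Z := rfl
/-- untouched field `aplus` -/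
theorem addShellLog_aplus : (G.addShellLog C).aplus = G.aplus := rfl
/-- untouched field `S` -/
theorem addShellLog_S : (G.addShellLog C).S = G.S := rfl
/-- untouched field `Bf` -/
theorem addShellLog_Bf : (G.addShellLog C).Bf = G.Bf := rfl
/-- untouched field `SL` -/
theorem addShellLog_SL : (G.addShellLog C).SL = G.SL := rfl

variable {G C}

/-- **The amendment preserves well-formedness** (`0 ≤ C`): nonnegativity is kept and the uniform ph-gain sum clause survives with `CF + 7C`
(`Σ_{n<N} klRelGain n ρ ≤ 40/9 ≤ 5`, `Σ_{n<N} 2^{−n} ≤ 2`). -/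
theorem addShellLog_wf (hG : G.WF) (hC : 0 ≤ C) : (G.addShellLog C).WF := by
  obtain ⟨h1, h2, h3, h4, h5, h6, h7, h8, h9, h10, h11, h12, h13, h14, h15, h16, h17, h18, h19, h20⟩ := hG
  refine ⟨h1, h2, h3, h4, h5, h6, h7, h8, h9, h10, h11, h12, ?_, ?_, ?_, ?_, h17, h18, h19, h20⟩
  · intro n ρ
    show 0 ≤ G.phGain n ρ + C * (klRelGain n (max ρ 0) + ((2 : ℝ) ^ n)⁻¹)
    have := klRelGain_nonneg n (le_max_right ρ 0)
    have := h13 n ρ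
    positivity
  · show 0 ≤ G.CF + 7 * C
    linarith
  · intro ρ N hρ
    show ∑ n ∈ range N, (G.phGain n ρ + C * (klRelGain n (max ρ 0) + ((2 : ℝ) ^ n)⁻¹)) ≤ G.CF + 7 * C
    rw [sum_add_distrib, ← mul_sum, sum_add_distrib, max_eq_left hρ]
    have hA := h15 ρ N hρ
    have hB := sum_range_klRelGain_le N hρ
    have hC2 : ∑ n ∈ range N, ((2 : ℝ) ^ n)⁻¹ ≤ 2 := by
      have e : ∀ n : ℕ, ((2 : ℝ) ^ n)⁻¹ = ((1 : ℝ) / 2) ^ n := fun n => by rw [one_div, inv_pow]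
      simp_rw [e]
      have hq0 : (0 : ℝ) ≤ 1 / 2 := by norm_num
      have hq1 : (1 : ℝ) / 2 < 1 := by norm_num
      calc ∑ n ∈ range N, ((1 : ℝ) / 2) ^ n ≤ ∑' n : ℕ, ((1 : ℝ) / 2) ^ n :=
            Summable.sum_le_tsum _ (fun i _ => by positivity) (summable_geometric_of_lt_one hq0 hq1)
        _ = 2 := by rw [tsum_geometric_of_lt_one hq0 hq1]; norm_num
    nlinarith
  · intro ρ t N hρ
    show ∑ n ∈ Ioc t N, G.ppGain n ρ ≤ G.CF + 7 * C
    exact (h16 ρ t N hρ).trans (by linarith)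

/-- The particle–hole gain grows: `G.phGain n ρ ≤ (G.addShellLog C).phGain n ρ` (`0 ≤ C`). -/
theorem phGain_le_addShellLog (hC : 0 ≤ C) (n : ℕ) (ρ : ℝ) : G.phGain n ρ ≤ (G.addShellLog C).phGain n ρ := by
  rw [addShellLog_phGain]
  have := klRelGain_nonneg n (le_max_right ρ 0)
  have : 0 ≤ C * (klRelGain n (max ρ 0) + ((2 : ℝ) ^ n)⁻¹) := by positivity
  linarith

/-- **The amended gain hosts the relative profile and the floor**: `C·(klRelGain n ρ + 2^{−n}) ≤ (G.addShellLog C).phGain n ρ` (`0 ≤ ρ`, `0 ≤ G.phGain n ρ`). -/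
theorem klRelGain_le_addShellLog {n : ℕ} {ρ : ℝ} (hph : 0 ≤ G.phGain n ρ) (hρ : 0 ≤ ρ) :
    C * (klRelGain n ρ + ((2 : ℝ) ^ n)⁻¹) ≤ (G.addShellLog C).phGain n ρ := by
  rw [addShellLog_phGain, max_eq_left hρ]
  linarith

/-- The freezing constant grows (`0 ≤ C`). -/
theorem CF_le_addShellLog (hC : 0 ≤ C) : G.CF ≤ (G.addShellLog C).CF := by
  rw [addShellLog_CF]; linarith

/-- **`pred_le` survives the amendment**: if `G.phGain (n−1) ρ ≤ 4·G.phGain n ρ` then the same holds for `G.addShellLog C` (`0 ≤ C`). -/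
theorem addShellLog_phGain_pred_le (hC : 0 ≤ C) {n : ℕ} {ρ : ℝ} (h : G.phGain (n - 1) ρ ≤ 4 * G.phGain n ρ) :
    (G.addShellLog C).phGain (n - 1) ρ ≤ 4 * (G.addShellLog C).phGain n ρ := by
  rw [addShellLog_phGain, addShellLog_phGain]
  have hg := klRelGain_pred_le n (le_max_right ρ 0)
  have h2 : ((2 : ℝ) ^ (n - 1))⁻¹ ≤ 4 * ((2 : ℝ) ^ n)⁻¹ := by
    rcases Nat.eq_zero_or_pos n with h0 | hn
    · subst h0; norm_num
    · obtain ⟨k, rfl⟩ : ∃ k, n = k + 1 := ⟨n - 1, by omega⟩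
      rw [Nat.add_sub_cancel, pow_succ, mul_inv]
      have : 0 < ((2 : ℝ) ^ k)⁻¹ := by positivity
      nlinarith
  have hk0 := klRelGain_nonneg n (le_max_right ρ 0)
  nlinarith

end GeoConsts

/-! ## §3 The hosting inequality: the relative bar of record under the amended package's rev-2 bar -/

section Hosting

variable {L : ℕ}

/-- `thermalBar` grows with the amendment (`0 ≤ C`). -/
theorem thermalBar_le_addShellLog {G : GeoConsts} {C : ℝ} (hC : 0 ≤ C) (P : SplitConsts) (U β : ℝ) (n : ℕ) :
    thermalBar G P U β n ≤ thermalBar (G.addShellLog C) P U β n := by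
  unfold thermalBar
  rw [GeoConsts.addShellLog_CF]
  have : 0 ≤ (P.Klam * U) ^ 2 * ((4 : ℝ) ^ (nScales β - n))⁻¹ := by positivity
  nlinarith

set_option maxHeartbeats 800000 in -- eight slot inequalities, each a small `nlinarith`, then one `linarith`
/-- **HOSTING**: for weights `0 ≤ ms ≤ c`, `ov ≤ c` and constants `0 ≤ r`, `r·c ≤ r′`, `r·c ≤ r′·C` (`0 ≤ C`, `0 ≤ P.Klam`, `0 ≤ G.CF`, `0 ≤ G.phGain`):
`transferBarRelAtWF G P r β U n ms ov Qm k k′ ≤ transferBarAt L (G.addShellLog C) P r′ β U n Qm k k′` — the bridge hypothesis of `pairTransferPinnedAt_of_rel`, discharged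
for the amended package (slot by slot: gains and floors into the amended ph gain, `1/L`, cubic and thermal into their namesakes). -/
theorem transferBarRelAtWF_le_transferBarAt_addShellLog {G : GeoConsts} (hCF : 0 ≤ G.CF) (hph : ∀ n ρ, 0 ≤ G.phGain n ρ) {P : SplitConsts}
    (hK : 0 ≤ P.Klam) {C c r r' : ℝ} (hC : 0 ≤ C) (hr : 0 ≤ r) (hrc : r * c ≤ r') (hrcC : r * c ≤ r' * C) (β U : ℝ) (n : ℕ) {ms ov : ℝ}
    (hms0 : 0 ≤ ms) (hms : ms ≤ c) (hov : ov ≤ c) (Qm k k' : TorusSite 2 L) :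
    transferBarRelAtWF L G P r β U n ms ov Qm k k' ≤ transferBarAt L (G.addShellLog C) P r' β U n Qm k k' := by
  rw [transferBarRelAtWF_eq]
  unfold transferBarAt
  rw [GeoConsts.addShellLog_phGain, GeoConsts.addShellLog_phGain]
  set ρd := klTorusNorm L (k - k') with hρd
  set ρx := klTorusNorm L (k + k' - Qm) with hρx
  have hρd0 : 0 ≤ ρd := by rw [hρd]; unfold klTorusNorm; exact torusSupNorm_nonneg _
  have hρx0 : 0 ≤ ρx := by rw [hρx]; unfold klTorusNorm; exact torusSupNorm_nonneg _
  rw [max_eq_left hρd0, max_eq_left hρx0]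
  have hgd := klRelGain_nonneg n hρd0
  have hgx := klRelGain_nonneg n hρx0
  have hpd := hph n ρd
  have hpx := hph n ρx
  have hth := thermalBar_le_addShellLog (G := G) hC P U β n
  have hth0 : 0 ≤ thermalBar G P U β n := by unfold thermalBar; positivity
  have hU2 : 0 ≤ (P.Klam * U) ^ 2 := by positivity
  have hU3 : 0 ≤ (P.Klam * |U|) ^ 3 := by have := mul_nonneg hK (abs_nonneg U); positivity
  have h2n : 0 < ((2 : ℝ) ^ n)⁻¹ := by positivity
  have h4n : ((4 : ℝ) ^ n)⁻¹ ≤ ((2 : ℝ) ^ n)⁻¹ := by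
    refine inv_anti₀ (by positivity) ?_
    exact pow_le_pow_left₀ (by norm_num) (by norm_num) n
  have h4n0 : 0 ≤ ((4 : ℝ) ^ n)⁻¹ := by positivity
  have hL0 : 0 ≤ ((L : ℝ))⁻¹ := by positivity
  have hr' : 0 ≤ r' := le_trans (mul_nonneg hr (le_trans hms0 hms)) hrc
  -- slot by slot (all products of nonnegative quantities)
  have s1 : r * ((P.Klam * U) ^ 2 * (klRelGain n ρd * ms)) ≤ r' * ((P.Klam * U) ^ 2 * (C * klRelGain n ρd)) := by
    have : r * ms ≤ r' * C := le_trans (mul_le_mul_of_nonneg_left hms hr) hrcC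
    nlinarith [mul_nonneg hU2 hgd]
  have s2 : r * ((P.Klam * U) ^ 2 * (klRelGain n ρx * ms)) ≤ r' * ((P.Klam * U) ^ 2 * (C * klRelGain n ρx)) := by
    have : r * ms ≤ r' * C := le_trans (mul_le_mul_of_nonneg_left hms hr) hrcC
    nlinarith [mul_nonneg hU2 hgx]
  have s3 : r * ((P.Klam * U) ^ 2 * (((2 : ℝ) ^ n)⁻¹ * ms)) ≤ r' * ((P.Klam * U) ^ 2 * (C * ((2 : ℝ) ^ n)⁻¹)) := by
    have : r * ms ≤ r' * C := le_trans (mul_le_mul_of_nonneg_left hms hr) hrcC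
    nlinarith [mul_nonneg hU2 h2n.le]
  have s4 : r * ((P.Klam * U) ^ 2 * (((4 : ℝ) ^ n)⁻¹ * ov)) ≤ r' * ((P.Klam * U) ^ 2 * (C * ((2 : ℝ) ^ n)⁻¹)) := by
    have : r * ov ≤ r' * C := le_trans (mul_le_mul_of_nonneg_left hov hr) hrcC
    nlinarith [mul_nonneg hU2 h4n0, mul_nonneg hU2 h2n.le, mul_nonneg (mul_nonneg hr' hC) hU2]
  have s5 : r * ((P.Klam * U) ^ 2 * (((L : ℝ))⁻¹ * ms)) ≤ r' * ((P.Klam * U) ^ 2 * ((L : ℝ))⁻¹) := by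
    have : r * ms ≤ r' := le_trans (mul_le_mul_of_nonneg_left hms hr) hrc
    nlinarith [mul_nonneg hU2 hL0]
  have s6 : r * ((P.Klam * |U|) ^ 3 * ((2 : ℝ) ^ n)⁻¹ * ms) ≤ r' * ((P.Klam * |U|) ^ 3 * ((2 : ℝ) ^ n)⁻¹) := by
    have : r * ms ≤ r' := le_trans (mul_le_mul_of_nonneg_left hms hr) hrc
    nlinarith [mul_nonneg hU3 h2n.le]
  have s7 : r * (thermalBar G P U β n * ms) ≤ r' * thermalBar (G.addShellLog C) P U β n := by
    have : r * ms ≤ r' := le_trans (mul_le_mul_of_nonneg_left hms hr) hrc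
    nlinarith [mul_nonneg hr' (le_trans hth0 hth)]
  have s8 : 0 ≤ r' * ((P.Klam * U) ^ 2 * (G.phGain n ρd + G.phGain n ρx)) := by positivity
  linarith [s1, s2, s3, s4, s5, s6, s7, s8]

end Hosting

end Summit.HubbardSuperconductivity.HubbardSuperconductivity.Theorems.KLRegimeSplit

end
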